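import Summits.PneNP.PneNP.Theorems.ChebyshevTracialDesignGammaDirectionCentredMoments
import HarnessLib

/-!
# Cell pnp-psdrank, route `ChebyshevTracialDesign`: the centred FIRST-moment profile of the γ-direction is termwise smooth
# (crux `TracialDecayExp20`, stmt-PneNP-19878)

Brick 133 (prover g26; MEMO-29 §3). Of brick 130's two open inputs, (iii) — relative level-smoothness of the centred first conditional moment
`B^m_c(x) = E_c[1_{X=x}(n_A − m)]` — needs NO new idea: by brick 131, `B^m_c(x) = ((t−c)/n)·L′_c − m·L_c` with `L′_c = Σ_{v∈reps vAA} law_{[n]∖e_v}(t−2,c;x−2)`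
and `L_c = law_c(x)`, an AFFINE level factor times a law minus a constant times a law, so its level differences are bounded TERMWISE by those of the two
laws (brick 129a's affine Leibniz rule):

* §1 **`abs_fwdDiff_iter_affSub_le`** (abstract): for `B_j = p(A − 2j)L′_j − mL_j` and `k ≥ 1`,
  `|Δ^kB(0)| ≤ |p||A|·|Δ^kL′(0)| + 2k|p|·(|Δ^{k−1}L′(0)| + |Δ^kL′(0)|) + |m|·|Δ^kL(0)|` (`Δ^{k−1}L′(1) = Δ^{k−1}L′(0) + Δ^kL′(0)`).
* §2 **`abs_fwdDiff_iter_centredFirst_le`** (shell instance): for a perfect matching `M`, block `H`, odd cut `t₀+2`, `x ∈ ℤ`, any real `m`, and `1 ≤ k` with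
  `2k+1 ≤ t₀+2`, `t₀+2+(2k+1) ≤ n`:
  `|Δ^k[j ↦ B^m_{2j+1}(x)](0)| ≤ ((t₀+1)/n)·|Δ^kL′(0)| + (2k/n)·(|Δ^{k−1}L′(0)| + |Δ^kL′(0)|) + |m|·|Δ^kL(0)|`,
  `L′_j = Σ_v law_{[n]∖e_v}(t₀,2j+1;x−2)`, `L_j = law_{[n]}(t₀+2,2j+1;x)`.
READING (MEMO-29 §3): with the centring `m = m₁(x) = ((t₀+1)/n)L′₀/L₀ ≤ a` (so `B^m_1(x) = 0`) and relative level-smoothness `|Δ^k L| ≤ η_k L`, `|Δ^k L′| ≤ η_k L′`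
of the two laws (types `(a,b,d)`, `(a−1,b,d)`; bricks 124/125's [BULK] in quantitative form), `Σ_k c_k|Δ^k B^m| ≲ a·L′₁·((t/n)Σc_kη_k + 1/n)`, to be compared with
`ε_B·√(A^m_1·law_1) = ε_B·law_1·√Var_1(n_A|X=x)`: (iii) holds with `ε_B ≍ √N·η_1 + a/(n√Var_1)` — small once `η_1 ≪ N^{−1/2}` on the window and `Var_1(n_A|x) ≳ N`
(the variance floor (V), a level-`1` line-section fact). The second-moment input (ii) is NOT termwise (MEMO-29 §3).
WHAT THIS FILE DOES NOT DO: supply `η_k` (the quantitative export of `ShellLawRelativeLevelSmoothness`), the variance floor (V), (ii), anything on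
`TracialDecayExp20` itself, psd rank of P_PM(K_n), or P vs NP.
[cite: Boole2009, Ch. II Art. 10 Ex. 3 eq. (8) (PDF pp. 34–35)] [cite: Agarwal2000DifferenceEquations, Thm. 1.8.5 (1.8.6)] [cite: Rothvoss2017, §2 (PDF p. 6)]
Stature: support/instrument (kernel lane, no defs, axioms standard). Supports stmt-PneNP-19878.
-/

set_option linter.dupNamespace false -- `Summit.PneNP.PneNP.…`: summit = sub-problem (D-0017)

noncomputable section

namespace Summit.PneNP.PneNP.Theorems.ChebyshevTracialDesignGammaDirectionFirstMoment

open Finset Polynomial Literature.Barriers.PneNP Literature.Combinatorics.Optimization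
open Literature.Combinatorics.Optimization.ShellStep
open Summit.PneNP.PneNP.Theorems.ChebyshevTracialDesignGammaDirectionTools (fwdDiff_iter_affMul fwdDiff_iter_one_congr_of_le)
open Summit.PneNP.PneNP.Theorems.ChebyshevTracialDesignGammaDirectionCentredMoments (centredFirst_eq_laws)

variable {n : ℕ}

/-! ### §1 The abstract termwise bound -/

/-- **Termwise differences of `p(A − 2j)L′_j − mL_j`**: for `k ≥ 1`,
`|Δ^k[p(A−2j)L′ − mL](0)| ≤ |p||A|·|Δ^kL′(0)| + 2k|p|·(|Δ^{k−1}L′(0)| + |Δ^kL′(0)|) + |m|·|Δ^kL(0)|`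
(brick 129a's affine Leibniz rule at `y = 0`, and `Δ^{k−1}L′(1) = Δ^{k−1}L′(0) + Δ^kL′(0)`). [cite: Boole2009, Ch. II Art. 10 Ex. 3 eq. (8) (PDF pp. 34–35)] -/
theorem abs_fwdDiff_iter_affSub_le (A p m : ℝ) (L L' : ℕ → ℝ) {k : ℕ} (hk : 1 ≤ k) :
    |(fwdDiff (1 : ℕ))^[k] (fun j : ℕ => p * (A - 2 * (j : ℝ)) * L' j - m * L j) 0| ≤
      |p| * |A| * |(fwdDiff (1 : ℕ))^[k] L' 0| +
        2 * (k : ℝ) * |p| * (|(fwdDiff (1 : ℕ))^[k - 1] L' 0| + |(fwdDiff (1 : ℕ))^[k] L' 0|) +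
        |m| * |(fwdDiff (1 : ℕ))^[k] L 0| := by
  have hsplit : (fun j : ℕ => p * (A - 2 * (j : ℝ)) * L' j - m * L j) =
      p • (fun j : ℕ => (A - 2 * (j : ℝ)) * L' j) + (-m) • L := by
    funext j; simp only [Pi.add_apply, Pi.smul_apply, smul_eq_mul]; ring
  rw [hsplit, fwdDiff_iter_add, fwdDiff_iter_const_smul, fwdDiff_iter_const_smul, Pi.add_apply, Pi.smul_apply, Pi.smul_apply,
    smul_eq_mul, smul_eq_mul, fwdDiff_iter_affMul]
  -- the shifted node: `Δ^{k-1} L′ (1) = Δ^{k-1} L′ (0) + Δ^k L′ (0)`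
  have hshift : (fwdDiff (1 : ℕ))^[k - 1] L' (0 + 1) = (fwdDiff (1 : ℕ))^[k - 1] L' 0 + (fwdDiff (1 : ℕ))^[k] L' 0 := by
    obtain ⟨i, rfl⟩ : ∃ i, k = i + 1 := ⟨k - 1, by omega⟩
    rw [Nat.add_sub_cancel, Function.iterate_succ_apply', fwdDiff]
    ring
  rw [hshift]
  simp only [Nat.cast_zero, mul_zero, sub_zero]
  have e1 : |p * (A * (fwdDiff (1 : ℕ))^[k] L' 0 - 2 * (k : ℝ) * ((fwdDiff (1 : ℕ))^[k - 1] L' 0 + (fwdDiff (1 : ℕ))^[k] L' 0))| ≤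
      |p| * |A| * |(fwdDiff (1 : ℕ))^[k] L' 0| +
        2 * (k : ℝ) * |p| * (|(fwdDiff (1 : ℕ))^[k - 1] L' 0| + |(fwdDiff (1 : ℕ))^[k] L' 0|) := by
    rw [abs_mul]
    have h1 := abs_sub (A * (fwdDiff (1 : ℕ))^[k] L' 0) (2 * (k : ℝ) * ((fwdDiff (1 : ℕ))^[k - 1] L' 0 + (fwdDiff (1 : ℕ))^[k] L' 0))
    have h2 := abs_add_le ((fwdDiff (1 : ℕ))^[k - 1] L' 0) ((fwdDiff (1 : ℕ))^[k] L' 0)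
    rw [abs_mul, abs_mul, abs_of_nonneg (by positivity : (0 : ℝ) ≤ 2 * (k : ℝ))] at h1
    have hp := abs_nonneg p
    have hk0 : (0 : ℝ) ≤ 2 * (k : ℝ) := by positivity
    calc |p| * |A * (fwdDiff (1 : ℕ))^[k] L' 0 - 2 * (k : ℝ) * ((fwdDiff (1 : ℕ))^[k - 1] L' 0 + (fwdDiff (1 : ℕ))^[k] L' 0)|
        ≤ |p| * (|A| * |(fwdDiff (1 : ℕ))^[k] L' 0| +
            2 * (k : ℝ) * (|(fwdDiff (1 : ℕ))^[k - 1] L' 0| + |(fwdDiff (1 : ℕ))^[k] L' 0|)) := by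
          refine mul_le_mul_of_nonneg_left (h1.trans ?_) hp
          gcongr
      _ = _ := by ring
  have e2 : |-m * (fwdDiff (1 : ℕ))^[k] L 0| = |m| * |(fwdDiff (1 : ℕ))^[k] L 0| := by rw [abs_mul, abs_neg]
  calc |p * (A * (fwdDiff (1 : ℕ))^[k] L' 0 - 2 * (k : ℝ) * ((fwdDiff (1 : ℕ))^[k - 1] L' 0 + (fwdDiff (1 : ℕ))^[k] L' 0)) +
          -m * (fwdDiff (1 : ℕ))^[k] L 0|
      ≤ |p * (A * (fwdDiff (1 : ℕ))^[k] L' 0 - 2 * (k : ℝ) * ((fwdDiff (1 : ℕ))^[k - 1] L' 0 + (fwdDiff (1 : ℕ))^[k] L' 0))| +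
          |-m * (fwdDiff (1 : ℕ))^[k] L 0| := abs_add_le _ _
    _ ≤ _ := by rw [e2]; exact add_le_add e1 le_rfl

/-! ### §2 The shell instance -/

/-- **The centred first-moment section is termwise smooth (brick 133).** For a perfect matching `M` (partner map `π`), a block `H`, an odd cut `t₀+2`,
`x ∈ ℤ`, a real `m`, and `k ≥ 1` with `2k+1 ≤ t₀+2` and `t₀+2+(2k+1) ≤ n`:
`|Δ^k[j ↦ B^m_{2j+1}(x)](0)| ≤ ((t₀+1)/n)·|Δ^kL′(0)| + (2k/n)·(|Δ^{k−1}L′(0)| + |Δ^kL′(0)|) + |m|·|Δ^kL(0)|`, where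
`B^m_c(x) = (Σ_{U ∈ Shell_c(M), |U∩H|=x} (n_A(U) − m))/|Shell_c(M)|`, `L′_j = Σ_{v ∈ reps(vAA)} law_{[n]∖e_v}(t₀, 2j+1; x−2)`, `L_j = law_{[n]}(t₀+2, 2j+1; x)`
(brick 131 on the levels `2j+1 ≤ 2k+1`, then §1 with `p = 1/n`, `A = t₀+1`). [cite: Rothvoss2017, §2 (PDF p. 6)]
[cite: Boole2009, Ch. II Art. 10 Ex. 3 eq. (8) (PDF pp. 34–35)] -/
theorem abs_fwdDiff_iter_centredFirst_le (M : PMatch n) (H : Finset (Fin n)) {t₀ : ℕ} (ht : Odd (t₀ + 2)) (x : ℤ) (m : ℝ)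
    {k : ℕ} (hk : 1 ≤ k) (hkt : 2 * k + 1 ≤ t₀ + 2) (hkn : t₀ + 2 + (2 * k + 1) ≤ n) :
    |(fwdDiff (1 : ℕ))^[k] (fun j : ℕ => ((∑ U ∈ ((shell M.2.partner (t₀ + 2) (2 * j + 1)).filter fun U => ((U ∩ H).card : ℤ) = x),
          (((((reps M.2.partner (vAA M.2.partner univ H)).filter fun v => v ∈ U ∧ M.2.partner v ∈ U).card : ℕ) : ℝ) - m)) /
          ((shell M.2.partner (t₀ + 2) (2 * j + 1)).card : ℝ))) 0| ≤
      (((t₀ : ℝ) + 1) / (n : ℝ)) * |(fwdDiff (1 : ℕ))^[k]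
          (fun j : ℕ => ∑ v ∈ reps M.2.partner (vAA M.2.partner univ H), shellLaw M.2.partner (univ \ {v, M.2.partner v}) H t₀ (2 * j + 1) (x - 2)) 0| +
        2 * (k : ℝ) / (n : ℝ) *
          (|(fwdDiff (1 : ℕ))^[k - 1]
              (fun j : ℕ => ∑ v ∈ reps M.2.partner (vAA M.2.partner univ H), shellLaw M.2.partner (univ \ {v, M.2.partner v}) H t₀ (2 * j + 1) (x - 2)) 0| +
            |(fwdDiff (1 : ℕ))^[k]
              (fun j : ℕ => ∑ v ∈ reps M.2.partner (vAA M.2.partner univ H), shellLaw M.2.partner (univ \ {v, M.2.partner v}) H t₀ (2 * j + 1) (x - 2)) 0|) +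
        |m| * |(fwdDiff (1 : ℕ))^[k] (fun j : ℕ => shellLaw M.2.partner univ H (t₀ + 2) (2 * j + 1) x) 0| := by
  set L' : ℕ → ℝ := fun j : ℕ => ∑ v ∈ reps M.2.partner (vAA M.2.partner univ H), shellLaw M.2.partner (univ \ {v, M.2.partner v}) H t₀ (2 * j + 1) (x - 2)
    with hL'
  set L : ℕ → ℝ := fun j : ℕ => shellLaw M.2.partner univ H (t₀ + 2) (2 * j + 1) x with hL
  -- brick 131 on the levels `2j+1`, `j ≤ k`
  have key := fwdDiff_iter_one_congr_of_le k (y := 0)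
    (f := (fun j : ℕ => ((∑ U ∈ ((shell M.2.partner (t₀ + 2) (2 * j + 1)).filter fun U => ((U ∩ H).card : ℤ) = x),
          (((((reps M.2.partner (vAA M.2.partner univ H)).filter fun v => v ∈ U ∧ M.2.partner v ∈ U).card : ℕ) : ℝ) - m)) /
          ((shell M.2.partner (t₀ + 2) (2 * j + 1)).card : ℝ))))
    (g := fun j : ℕ => (1 / (n : ℝ)) * (((t₀ : ℝ) + 1) - 2 * (j : ℝ)) * L' j - m * L j)
    (fun i hi => by
      simp only [zero_add, hL', hL]
      rw [centredFirst_eq_laws M H ht ⟨i, rfl⟩ (by omega) (by omega) x m]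
      push_cast
      ring)
  rw [key]
  have h := abs_fwdDiff_iter_affSub_le ((t₀ : ℝ) + 1) (1 / (n : ℝ)) m L L' hk
  have hn0 : (0 : ℝ) ≤ 1 / (n : ℝ) := by positivity
  rw [abs_of_nonneg hn0, abs_of_nonneg (by positivity : (0 : ℝ) ≤ (t₀ : ℝ) + 1)] at h
  refine h.trans (le_of_eq ?_)
  ring

end Summit.PneNP.PneNP.Theorems.ChebyshevTracialDesignGammaDirectionFirstMoment

end
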